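import Mathlib
import Summits.Ventures.PercRepro2.Bernstein
import Summits.Ventures.PercRepro2.LastVertex

/-!
# Port minima of clutters, and the pattern-positivity route to their log-concave tails
(seat mine-b, cell pub-perc-repro2)

For a clutter `𝒞` of edge sets (the PORT of a matroid at an element: `s–t` cuts for the cographic
matroid of `G + st`, `s–t` paths for the graphic one) the **port minimum** `portMin 𝒞 ω` is the
least number of open edges of `ω` in a member of `𝒞` — the `s–t` max-flow (Menger) for the cut
clutter, the distance to the connection event for the path clutter (MINE-B.md §8.3,
proofs/MINE-B-DUAL.md).  `portEvent 𝒞 k = {portMin ≥ k}`.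

`portTail_logconcave_of_patternCoeff_nonneg` is the proof shape of record for rows B2 / B2* / B2-REG:
if every two-configuration pattern coefficient of the quadruple `({≥k}, {≥k}, {≥k−1}, {≥k+1})` is
nonnegative (a FINITE check for a given clutter — done by computer for every port of `R₁₀`, of
`R₁₂`, of six 2-sums with `R₁₀`, and for the cut / path clutters of all graphs on ≤ 7 vertices with
bounded edge numbers) then `P(τ ≥ k−1)·P(τ ≥ k+1) ≤ P(τ ≥ k)²` holds for EVERY product measure, by
mine-1's Bernstein expansion `slack_nonneg_of_patternCoeff_nonneg`.  Likewise for the balanced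
family `BAL(a,b)`.
-/

open Finset

namespace Summit.Ventures.PercRepro2

variable {E : Type*} [Fintype E] [DecidableEq E]

/-- the number of open edges of `ω` inside the edge set `X` -/
def portOpenCount (ω : Config E) (X : Finset E) : ℕ := (X.filter (fun e => ω e = true)).card

/-- the port minimum: the least number of open edges in a member of the clutter (`0` for the empty
clutter would be `⊤`; we use `sInf` on `ℕ`, which is `0` for the empty set — the clutters of interest
are nonempty) -/
noncomputable def portMin (𝒞 : Finset (Finset E)) (ω : Config E) : ℕ :=
  sInf ((𝒞.image (portOpenCount ω)) : Set ℕ)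

/-- the event `portMin ≥ k` -/
def portEvent (𝒞 : Finset (Finset E)) (k : ℕ) : Set (Config E) := {ω | k ≤ portMin 𝒞 ω}

omit [Fintype E] in
/-- `portMin` is monotone in the configuration -/
theorem portMin_mono (𝒞 : Finset (Finset E)) {ω ω' : Config E} (h : ∀ e, ω e = true → ω' e = true) :
    portMin 𝒞 ω ≤ portMin 𝒞 ω' := by
  unfold portMin
  by_cases hne : 𝒞 = ∅
  · subst hne; simp
  · obtain ⟨X, hX⟩ := Finset.nonempty_iff_ne_empty.2 hne
    have hmem : portOpenCount ω' X ∈ ((𝒞.image (portOpenCount ω')) : Set ℕ) := by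
      simp only [Finset.coe_image, Set.mem_image, Finset.mem_coe]; exact ⟨X, hX, rfl⟩
    -- sInf over the image of ω' is attained at some X'
    have hne' : ((𝒞.image (portOpenCount ω')) : Set ℕ).Nonempty := ⟨_, hmem⟩
    obtain ⟨Y, hY, hYeq⟩ : ∃ Y ∈ 𝒞, portOpenCount ω' Y = sInf ((𝒞.image (portOpenCount ω')) : Set ℕ) := by
      have := Nat.sInf_mem hne'
      rw [Finset.coe_image] at this
      obtain ⟨Y, hY, hYeq⟩ := this
      exact ⟨Y, hY, by rw [hYeq, Finset.coe_image]⟩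
    rw [← hYeq]
    apply le_trans (Nat.sInf_le ?_) ?_
    · exact portOpenCount ω Y
    · simp only [Finset.coe_image, Set.mem_image, Finset.mem_coe]; exact ⟨Y, hY, rfl⟩
    · unfold portOpenCount
      apply Finset.card_le_card
      intro e he
      simp only [Finset.mem_filter] at he ⊢
      exact ⟨he.1, h e he.2⟩

omit [Fintype E] in
/-- the events `{portMin ≥ k}` are increasing -/
theorem portEvent_incr (𝒞 : Finset (Finset E)) (k : ℕ) {ω ω' : Config E}
    (h : ∀ e, ω e = true → ω' e = true) (hω : ω ∈ portEvent 𝒞 k) : ω' ∈ portEvent 𝒞 k :=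
  le_trans hω (portMin_mono 𝒞 h)

omit [Fintype E] [DecidableEq E] in
/-- the events are nested: `{portMin ≥ k+1} ⊆ {portMin ≥ k}` -/
theorem portEvent_succ_subset (𝒞 : Finset (Finset E)) (k : ℕ) :
    portEvent 𝒞 (k + 1) ⊆ portEvent 𝒞 k := fun _ h => le_trans (Nat.le_succ k) h

/-- **Pattern positivity ⇒ log-concave tail** (the proof shape of record for rows B2 / B2* / B2-REG):
if every two-configuration pattern coefficient of `({≥k},{≥k},{≥k−1},{≥k+1})` is nonnegative, then
`P(τ ≥ k−1)·P(τ ≥ k+1) ≤ P(τ ≥ k)²` for every admissible weight vector. -/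
theorem portTail_logconcave_of_patternCoeff_nonneg {p : E → ℝ} (hp : IsProbVec p)
    (𝒞 : Finset (Finset E)) (k : ℕ)
    (hc : ∀ mj : Config E × Config E,
      (0 : ℝ) ≤ patternCoeff (portEvent 𝒞 k) (portEvent 𝒞 k) (portEvent 𝒞 (k - 1)) (portEvent 𝒞 (k + 1)) mj) :
    prob p (portEvent 𝒞 (k - 1)) * prob p (portEvent 𝒞 (k + 1))
      ≤ prob p (portEvent 𝒞 k) * prob p (portEvent 𝒞 k) := by
  have h := slack_nonneg_of_patternCoeff_nonneg hp (portEvent 𝒞 k) (portEvent 𝒞 k)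
    (portEvent 𝒞 (k - 1)) (portEvent 𝒞 (k + 1)) hc
  unfold slack at h
  linarith

/-- **Pattern positivity ⇒ the balanced inequality `BAL(a,b)`**:
`P(τ ≥ a−1)·P(τ ≥ b+1) ≤ P(τ ≥ a)·P(τ ≥ b)` for every admissible weight vector. -/
theorem portTail_balanced_of_patternCoeff_nonneg {p : E → ℝ} (hp : IsProbVec p)
    (𝒞 : Finset (Finset E)) (a b : ℕ)
    (hc : ∀ mj : Config E × Config E,
      (0 : ℝ) ≤ patternCoeff (portEvent 𝒞 a) (portEvent 𝒞 b) (portEvent 𝒞 (a - 1)) (portEvent 𝒞 (b + 1)) mj) :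
    prob p (portEvent 𝒞 (a - 1)) * prob p (portEvent 𝒞 (b + 1))
      ≤ prob p (portEvent 𝒞 a) * prob p (portEvent 𝒞 b) := by
  have h := slack_nonneg_of_patternCoeff_nonneg hp (portEvent 𝒞 a) (portEvent 𝒞 b)
    (portEvent 𝒞 (a - 1)) (portEvent 𝒞 (b + 1)) hc
  unfold slack at h
  linarith

end Summit.Ventures.PercRepro2
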